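import Summits.Ventures.Crystal3D.Theorems.StickyWulffConstantGenericWallFloorAtHalfTiltDown
import Summits.Ventures.Crystal3D.Theorems.StickyWulffConstantGenericWallFloorSigma9Full
import HarnessLib

/-!
# In-plane STACK WALKERS for a TWIN pair: lane G's one-sided tilted ledger gives the clamped-cell inequality at
# charge `(√2/2)⟪A d, e₃⟫` for every twin pair whose composition plane carries a walkable in-plane slot — ARBITRARY fillings
# (crux `CoaxialWallLaw`, stmt-Ventures-19481, line `WallLedgerF`; tool transfer from `GenericWallFloor`, line `WallLedgerG`)

HONEST FRAMING. Venture `Summits/Ventures/Crystal3D` (cell `crystal3d-full`), helper `--supports` the crux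
`CoaxialWallLaw` of `route-Ventures-StickyWulffConstant` (registered line `WallLedgerF`, open stub
`stub_coaxialTwoSlabAdhesion`, ARBITRARY fillings).  Rung credit only; F-C1 not moved; NOT the stub: only TWIN pairs
(`A₂·Λ₀ = (wordFrame A₁ [μ])·Λ₀`, not translation pairs with equal linear lattices), only composition planes carrying an
in-plane slot of `e₃`-component `≥ 13/25` (tilt `≳ 37°`), and the certified computations `ExactOnly`(C12-55) [E1] and
`StarPairFar` of lane G are inputs BY NAME.

THE OBSERVATION.  Lane G's stack walkers (19480-p2/p1) pay residual-free whenever no frame on the walker's stack has the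
far LINEAR lattice.  For a twin pair and a walker launched along a slot `d` lying IN the composition plane (`⟪d, μ⟫ = 0`),
every frame on the stack is `wordFrame A₁ α` for a stack word `α` whose last letter is POSITIVE on `d` (the first push
normal), so `α` can never have the mirror sequence of `[μ]` (`map_reflection_eq_of_image_eq`,
`eq_or_eq_neg_of_reflection_eq`): **`image_ne_twin_of_inPlane_stack`** — the `|κ| = 1` case that `image_ne_of_word`
(`|κ| ≥ 2`) leaves out.  In-plane slots are steep only for TILTED verticals, which the tilted one-sided ledgers
`twoSlabAdhesion_stackLedger_oneSided_tilt` / `…Down_tilt` (19480-p1 g7) accept.  Hence, for ARBITRARY fillings: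

* `twoSlabLedger_twin_inPlane_tilt_of_far` / `…Down…` — twin pair, unit `z` with `‖z ∓ e₃‖ ≤ 1/4`, in-plane slot `d`
  steep for `z`: `TwoSlabLedgerAt ((√2/2)|⟪A d, e₃⟫|)` (the cell inequality of BOTH lanes' stubs at that charge, no residual);
* **`twoSlabLedger_twin_inPlane_of_inner_ge`** / `…_of_inner_le` — the same for every in-plane slot with `⟪A₁d, e₃⟫ ≥ 13/25`
  (resp. `⟪A₂d, e₃⟫ ≤ −13/25`), no vertical in the statement; charge `≥ 0.367`;
* `twoSlabLedgerAt_mono` and **`twoSlabLedger_twin_of_sin_le`** — the cell inequality at lane F's charge `½·s` for any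
  `s ≤ √2⟪A₁ d, e₃⟫` (lane F takes `s = sin θ = √(1 − ⟪ν, e₃⟫²)`; the steepest in-plane slot of a plane tilted by `θ` has
  `e₃`-component `≥ (√3/2) sin θ`, so `√2·` that `≥ 1.22 sin θ ≥ sin θ`; choosing the slot is left to the F seat).
READING for lane F: on twin pairs with `sin θ ≥ 0.6` the stub's inequality (charge `½ sin θ`) holds for ARBITRARY fillings
from ONE grain's in-plane walkers, modulo E1 and StarPairFar; the census-free record was `(√6/156)·sin θ′`.  Translation
pairs (`A₂·Λ₀ = A₁·Λ₀`) are NOT covered (the bottom frame itself has the far lattice).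
WHAT THIS IS NOT: not `stub_coaxialTwoSlabAdhesion` (translation pairs, shallow planes, and the `∃ L` packaging remain);
F-C1 not moved.
-/

noncomputable section

namespace Summit.Ventures.Crystal3D.Theorems

open Summit.Ventures.Crystal3D Finset
open Literature.MathematicalPhysics.StatisticalMechanics (fccStacking barlowStacking IsHaggSeq contactDeficiency)
open scoped InnerProductSpace

/-! ### The `|κ| = 1` word criterion: in-plane stacks never carry the twin lattice -/

/-- **In-plane stacks never carry the twin lattice.**  `μ` a unit model menu normal, `u` a slot IN its plane
(`⟪u, μ⟫ = 0`); then no frame of a sound well-formed stack over `(A, u, 0)` (any vertical) has the lattice of the twin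
`wordFrame A [μ]`. -/
theorem image_ne_twin_of_inPlane_stack {A : EuclideanSpace ℝ (Fin 3) ≃ₗᵢ[ℝ] EuclideanSpace ℝ (Fin 3)}
    {u μ : EuclideanSpace ℝ (Fin 3)}
    (hμ : ‖μ‖ = 1 ∧ ∀ w ∈ fccSlots, ⟪w, μ⟫_ℝ = 0 ∨ ⟪w, μ⟫_ℝ = Real.sqrt (2 / 3) ∨ ⟪w, μ⟫_ℝ = -Real.sqrt (2 / 3))
    (hu : ⟪u, μ⟫_ℝ = 0)
    {z : EuclideanSpace ℝ (Fin 3)} {stk : List WalkEntry}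
    (hS : StackSound z stk) (hW : StackWF z stk) (hl : stk.getLast? = some ⟨A, u, 0⟩)
    {e : WalkEntry} (he : e ∈ stk) :
    e.frame '' fccStacking 1 (Real.sqrt (2 / 3)) ≠ (wordFrame A [μ]) '' fccStacking 1 (Real.sqrt (2 / 3)) := by
  intro hEq
  have hr : 0 < Real.sqrt (2 / 3) := Real.sqrt_pos.2 (by norm_num)
  obtain ⟨r, hS', hW', hl'⟩ := exists_suffix_of_mem stk e he hS hW
  rw [hl] at hl'
  obtain ⟨hαl, hαc⟩ := stackWord_letters _ hS' hW'
  have hF : e.frame = wordFrame A (stackWord (e :: r)) := by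
    rw [frame_eq_wordFrame e r hS', stackBase_eq_of_getLast? hl']
  have hαpos : ∀ μ', (stackWord (e :: r)).getLast? = some μ' → ⟪u, μ'⟫_ℝ = Real.sqrt (2 / 3) :=
    fun μ' hμ' => inner_dir_getLast_stackWord r e ⟨A, u, 0⟩ hS' hl' μ' hμ'
  have himg := image_fccSlots_eq_of_image_fcc_eq _ _ hEq
  rw [hF] at himg
  have hmap := map_reflection_eq_of_image_eq A hαl hαc
    (fun μ' hμ' => by rw [List.mem_singleton] at hμ'; rw [hμ']; exact hμ) (List.isChain_singleton _) himg
  -- the stack word has exactly one letter, with the same mirror as `μ`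
  cases hsw : stackWord (e :: r) with
  | nil => rw [hsw] at hmap; simp at hmap
  | cons ν rest =>
    rw [hsw] at hmap hαpos hαl
    have hlen := congrArg List.length hmap
    simp only [List.map_cons, List.length_cons, List.length_map, List.map_nil, List.length_nil] at hlen
    have hrest : rest = [] := List.eq_nil_of_length_eq_zero (by omega)
    subst hrest
    have hνu : ‖ν‖ = 1 := (hαl ν (by simp)).1
    have hνpos : ⟪u, ν⟫_ℝ = Real.sqrt (2 / 3) := hαpos ν rfl
    simp only [List.map_cons, List.map_nil, List.cons.injEq, and_true] at hmap
    rcases eq_or_eq_neg_of_reflection_eq hνu hμ.1 hmap with h | h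
    · rw [h, hu] at hνpos; linarith
    · rw [h, inner_neg_right, hu, neg_zero] at hνpos; linarith

/-! ### Lowering the charge -/

/-- Lowering the charge only weakens the per-pair ledger statement. -/
theorem twoSlabLedgerAt_mono {q q' : ℝ} (hqq : q ≤ q')
    {A₁ : EuclideanSpace ℝ (Fin 3) ≃ₗᵢ[ℝ] EuclideanSpace ℝ (Fin 3)} {t₁ : EuclideanSpace ℝ (Fin 3)}
    {A₂ : EuclideanSpace ℝ (Fin 3) ≃ₗᵢ[ℝ] EuclideanSpace ℝ (Fin 3)} {t₂ : EuclideanSpace ℝ (Fin 3)}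
    (h : TwoSlabLedgerAt q' A₁ t₁ A₂ t₂) : TwoSlabLedgerAt q A₁ t₁ A₂ t₂ := by
  obtain ⟨C, R₀, hR₀, hall⟩ := h
  refine ⟨C, R₀, hR₀, fun hh hh0 ρ hρ X P₁ P₂ hX hP₁ hP₂ hcell hP₁i hP₂i => ?_⟩
  have := hall hh hh0 ρ hρ X P₁ P₂ hX hP₁ hP₂ hcell hP₁i hP₂i
  have hπρ : 0 ≤ Real.pi * ρ ^ 2 := by positivity
  nlinarith

/-! ### Twin pairs: grain 1's in-plane walkers -/

open scoped Classical in
/-- **Twin pair, in-plane slot of grain 1 steep for a tilted vertical**: `A₂·Λ₀ = (wordFrame A₁ [μ])·Λ₀`, unit `z` with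
`‖z − e₃‖ ≤ 1/4`, slot `d₁` with `⟪d₁, μ⟫ = 0` and `⟪A₁ d₁, z⟫ ≥ √2/2`: the clamped-cell inequality at charge
`(√2/2)|⟪A₁d₁, e₃⟫|`, ARBITRARY fillings, modulo `ExactOnly`(C12-55) and `StarPairFar`. -/
theorem twoSlabLedger_twin_inPlane_tilt_of_far
    {s₀ : EuclideanSpace ℝ (Fin 3)} (hs₀ : s₀ ∈ fccSlots)
    (hcert : ExactOnly 0 (fccSlots.filter fun w => 0 < ⟪w, s₀⟫_ℝ)) (hfar : StarPairFar)
    (A₁ : EuclideanSpace ℝ (Fin 3) ≃ₗᵢ[ℝ] EuclideanSpace ℝ (Fin 3)) (t₁ : EuclideanSpace ℝ (Fin 3))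
    (A₂ : EuclideanSpace ℝ (Fin 3) ≃ₗᵢ[ℝ] EuclideanSpace ℝ (Fin 3)) (t₂ : EuclideanSpace ℝ (Fin 3))
    {μ : EuclideanSpace ℝ (Fin 3)}
    (hμ : ‖μ‖ = 1 ∧ ∀ w ∈ fccSlots, ⟪w, μ⟫_ℝ = 0 ∨ ⟪w, μ⟫_ℝ = Real.sqrt (2 / 3) ∨ ⟪w, μ⟫_ℝ = -Real.sqrt (2 / 3))
    (hA₂ : A₂ '' fccStacking 1 (Real.sqrt (2 / 3)) = (wordFrame A₁ [μ]) '' fccStacking 1 (Real.sqrt (2 / 3)))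
    {z : EuclideanSpace ℝ (Fin 3)} (hz : ‖z‖ = 1) (hze : ‖z - EuclideanSpace.single (2 : Fin 3) (1 : ℝ)‖ ≤ 1 / 4)
    {d₁ : EuclideanSpace ℝ (Fin 3)} (hd₁ : d₁ ∈ fccSlots) (hplane : ⟪d₁, μ⟫_ℝ = 0)
    (hsteep : Real.sqrt 2 / 2 ≤ ⟪A₁ d₁, z⟫_ℝ) :
    TwoSlabLedgerAt (Real.sqrt 2 * |⟪A₁ d₁, EuclideanSpace.single (2 : Fin 3) (1 : ℝ)⟫_ℝ| / 2) A₁ t₁ A₂ t₂ :=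
  twoSlabAdhesion_stackLedger_oneSided_tilt hs₀ hcert (doubleStarCoaxialAt_of_starPairFar hfar)
    (capPairCoaxial_of_starPairFar hfar) A₁ t₁ A₂ t₂ hz hze hd₁ hsteep
    {F | ∃ stk : List WalkEntry, StackSound z stk ∧ StackWF z stk ∧ stk.getLast? = some ⟨A₁, d₁, 0⟩ ∧
      ∃ e ∈ stk, e.frame = F}
    (fun stk hS hW hlast e he => ⟨stk, hS, hW, hlast, e, he, rfl⟩)
    (fun _ ⟨_, hS, hW, hl, _, he, hF⟩ => by
      rw [← hF, hA₂]; exact image_ne_twin_of_inPlane_stack hμ hplane hS hW hl he)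

open scoped Classical in
/-- **Twin pair, ANY in-plane slot of grain 1 with `e₃`-component `≥ 13/25`** (vertical by `exists_tilt_vertical`):
the clamped-cell inequality at charge `(√2/2)⟪A₁d₁, e₃⟫ ≥ 0.367`, arbitrary fillings, modulo `ExactOnly`(C12-55) and
`StarPairFar`. -/
theorem twoSlabLedger_twin_inPlane_of_inner_ge
    {s₀ : EuclideanSpace ℝ (Fin 3)} (hs₀ : s₀ ∈ fccSlots)
    (hcert : ExactOnly 0 (fccSlots.filter fun w => 0 < ⟪w, s₀⟫_ℝ)) (hfar : StarPairFar)
    (A₁ : EuclideanSpace ℝ (Fin 3) ≃ₗᵢ[ℝ] EuclideanSpace ℝ (Fin 3)) (t₁ : EuclideanSpace ℝ (Fin 3))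
    (A₂ : EuclideanSpace ℝ (Fin 3) ≃ₗᵢ[ℝ] EuclideanSpace ℝ (Fin 3)) (t₂ : EuclideanSpace ℝ (Fin 3))
    {μ : EuclideanSpace ℝ (Fin 3)}
    (hμ : ‖μ‖ = 1 ∧ ∀ w ∈ fccSlots, ⟪w, μ⟫_ℝ = 0 ∨ ⟪w, μ⟫_ℝ = Real.sqrt (2 / 3) ∨ ⟪w, μ⟫_ℝ = -Real.sqrt (2 / 3))
    (hA₂ : A₂ '' fccStacking 1 (Real.sqrt (2 / 3)) = (wordFrame A₁ [μ]) '' fccStacking 1 (Real.sqrt (2 / 3)))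
    {d₁ : EuclideanSpace ℝ (Fin 3)} (hd₁ : d₁ ∈ fccSlots) (hplane : ⟪d₁, μ⟫_ℝ = 0)
    (hup : (13 / 25 : ℝ) ≤ ⟪A₁ d₁, EuclideanSpace.single (2 : Fin 3) (1 : ℝ)⟫_ℝ) :
    TwoSlabLedgerAt (Real.sqrt 2 * ⟪A₁ d₁, EuclideanSpace.single (2 : Fin 3) (1 : ℝ)⟫_ℝ / 2) A₁ t₁ A₂ t₂ := by
  obtain ⟨z, hz, hze, hsteep⟩ := exists_tilt_vertical
    (by rw [LinearIsometryEquiv.norm_map, norm_eq_one_of_mem_fccSlots hd₁]) hup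
  have h := twoSlabLedger_twin_inPlane_tilt_of_far hs₀ hcert hfar A₁ t₁ A₂ t₂ hμ hA₂ hz hze hd₁ hplane hsteep
  rwa [abs_of_nonneg (by linarith : (0 : ℝ) ≤ ⟪A₁ d₁, EuclideanSpace.single (2 : Fin 3) (1 : ℝ)⟫_ℝ)] at h

open scoped Classical in
/-- **Lane F's charge shape.**  Under the hypotheses of `twoSlabLedger_twin_inPlane_of_inner_ge`, the cell inequality holds at
charge `½·s` for every `s ≤ √2⟪A₁ d₁, e₃⟫` — lane F takes `s = sin θ`, which the steepest in-plane slot of a plane tilted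
by `θ` always beats (`√2 · (√3/2) sin θ ≥ sin θ`). -/
theorem twoSlabLedger_twin_of_sin_le
    {s₀ : EuclideanSpace ℝ (Fin 3)} (hs₀ : s₀ ∈ fccSlots)
    (hcert : ExactOnly 0 (fccSlots.filter fun w => 0 < ⟪w, s₀⟫_ℝ)) (hfar : StarPairFar)
    (A₁ : EuclideanSpace ℝ (Fin 3) ≃ₗᵢ[ℝ] EuclideanSpace ℝ (Fin 3)) (t₁ : EuclideanSpace ℝ (Fin 3))
    (A₂ : EuclideanSpace ℝ (Fin 3) ≃ₗᵢ[ℝ] EuclideanSpace ℝ (Fin 3)) (t₂ : EuclideanSpace ℝ (Fin 3))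
    {μ : EuclideanSpace ℝ (Fin 3)}
    (hμ : ‖μ‖ = 1 ∧ ∀ w ∈ fccSlots, ⟪w, μ⟫_ℝ = 0 ∨ ⟪w, μ⟫_ℝ = Real.sqrt (2 / 3) ∨ ⟪w, μ⟫_ℝ = -Real.sqrt (2 / 3))
    (hA₂ : A₂ '' fccStacking 1 (Real.sqrt (2 / 3)) = (wordFrame A₁ [μ]) '' fccStacking 1 (Real.sqrt (2 / 3)))
    {d₁ : EuclideanSpace ℝ (Fin 3)} (hd₁ : d₁ ∈ fccSlots) (hplane : ⟪d₁, μ⟫_ℝ = 0)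
    (hup : (13 / 25 : ℝ) ≤ ⟪A₁ d₁, EuclideanSpace.single (2 : Fin 3) (1 : ℝ)⟫_ℝ) {s : ℝ}
    (hs : s ≤ Real.sqrt 2 * ⟪A₁ d₁, EuclideanSpace.single (2 : Fin 3) (1 : ℝ)⟫_ℝ) :
    TwoSlabLedgerAt (1 / 2 * s) A₁ t₁ A₂ t₂ :=
  twoSlabLedgerAt_mono (by linarith) (twoSlabLedger_twin_inPlane_of_inner_ge hs₀ hcert hfar A₁ t₁ A₂ t₂ hμ hA₂ hd₁ hplane hup)

/-! ### Twin pairs: grain 2's in-plane walkers -/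

open scoped Classical in
/-- **Twin pair presented over grain 2 (`A₁·Λ₀ = (wordFrame A₂ [μ])·Λ₀`), in-plane slot of grain 2 steep for a tilted
vertical** (`‖z + e₃‖ ≤ 1/4`): the cell inequality at charge `(√2/2)|⟪A₂d₂, e₃⟫|`, arbitrary fillings. -/
theorem twoSlabLedger_twinDown_inPlane_tilt_of_far
    {s₀ : EuclideanSpace ℝ (Fin 3)} (hs₀ : s₀ ∈ fccSlots)
    (hcert : ExactOnly 0 (fccSlots.filter fun w => 0 < ⟪w, s₀⟫_ℝ)) (hfar : StarPairFar)
    (A₁ : EuclideanSpace ℝ (Fin 3) ≃ₗᵢ[ℝ] EuclideanSpace ℝ (Fin 3)) (t₁ : EuclideanSpace ℝ (Fin 3))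
    (A₂ : EuclideanSpace ℝ (Fin 3) ≃ₗᵢ[ℝ] EuclideanSpace ℝ (Fin 3)) (t₂ : EuclideanSpace ℝ (Fin 3))
    {μ : EuclideanSpace ℝ (Fin 3)}
    (hμ : ‖μ‖ = 1 ∧ ∀ w ∈ fccSlots, ⟪w, μ⟫_ℝ = 0 ∨ ⟪w, μ⟫_ℝ = Real.sqrt (2 / 3) ∨ ⟪w, μ⟫_ℝ = -Real.sqrt (2 / 3))
    (hA₁ : A₁ '' fccStacking 1 (Real.sqrt (2 / 3)) = (wordFrame A₂ [μ]) '' fccStacking 1 (Real.sqrt (2 / 3)))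
    {z : EuclideanSpace ℝ (Fin 3)} (hz : ‖z‖ = 1) (hze : ‖z + EuclideanSpace.single (2 : Fin 3) (1 : ℝ)‖ ≤ 1 / 4)
    {d₂ : EuclideanSpace ℝ (Fin 3)} (hd₂ : d₂ ∈ fccSlots) (hplane : ⟪d₂, μ⟫_ℝ = 0)
    (hsteep : Real.sqrt 2 / 2 ≤ ⟪A₂ d₂, z⟫_ℝ) :
    TwoSlabLedgerAt (Real.sqrt 2 * |⟪A₂ d₂, EuclideanSpace.single (2 : Fin 3) (1 : ℝ)⟫_ℝ| / 2) A₁ t₁ A₂ t₂ :=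
  twoSlabAdhesion_stackLedger_oneSidedDown_tilt hs₀ hcert (doubleStarCoaxialAt_of_starPairFar hfar)
    (capPairCoaxial_of_starPairFar hfar) A₁ t₁ A₂ t₂ hz hze hd₂ hsteep
    {F | ∃ stk : List WalkEntry, StackSound z stk ∧ StackWF z stk ∧ stk.getLast? = some ⟨A₂, d₂, 0⟩ ∧
      ∃ e ∈ stk, e.frame = F}
    (fun stk hS hW hlast e he => ⟨stk, hS, hW, hlast, e, he, rfl⟩)
    (fun _ ⟨_, hS, hW, hl, _, he, hF⟩ => by
      rw [← hF, hA₁]; exact image_ne_twin_of_inPlane_stack hμ hplane hS hW hl he)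

open scoped Classical in
/-- **Twin pair, ANY in-plane slot of grain 2 with `e₃`-component `≤ −13/25`**: the cell inequality at charge
`(√2/2)|⟪A₂d₂, e₃⟫| ≥ 0.367`, arbitrary fillings, modulo `ExactOnly`(C12-55) and `StarPairFar`. -/
theorem twoSlabLedger_twinDown_inPlane_of_inner_le
    {s₀ : EuclideanSpace ℝ (Fin 3)} (hs₀ : s₀ ∈ fccSlots)
    (hcert : ExactOnly 0 (fccSlots.filter fun w => 0 < ⟪w, s₀⟫_ℝ)) (hfar : StarPairFar)
    (A₁ : EuclideanSpace ℝ (Fin 3) ≃ₗᵢ[ℝ] EuclideanSpace ℝ (Fin 3)) (t₁ : EuclideanSpace ℝ (Fin 3))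
    (A₂ : EuclideanSpace ℝ (Fin 3) ≃ₗᵢ[ℝ] EuclideanSpace ℝ (Fin 3)) (t₂ : EuclideanSpace ℝ (Fin 3))
    {μ : EuclideanSpace ℝ (Fin 3)}
    (hμ : ‖μ‖ = 1 ∧ ∀ w ∈ fccSlots, ⟪w, μ⟫_ℝ = 0 ∨ ⟪w, μ⟫_ℝ = Real.sqrt (2 / 3) ∨ ⟪w, μ⟫_ℝ = -Real.sqrt (2 / 3))
    (hA₁ : A₁ '' fccStacking 1 (Real.sqrt (2 / 3)) = (wordFrame A₂ [μ]) '' fccStacking 1 (Real.sqrt (2 / 3)))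
    {d₂ : EuclideanSpace ℝ (Fin 3)} (hd₂ : d₂ ∈ fccSlots) (hplane : ⟪d₂, μ⟫_ℝ = 0)
    (hdown : ⟪A₂ d₂, EuclideanSpace.single (2 : Fin 3) (1 : ℝ)⟫_ℝ ≤ -(13 / 25 : ℝ)) :
    TwoSlabLedgerAt (Real.sqrt 2 * |⟪A₂ d₂, EuclideanSpace.single (2 : Fin 3) (1 : ℝ)⟫_ℝ| / 2) A₁ t₁ A₂ t₂ := by
  obtain ⟨z, hz, hze, hsteep⟩ := exists_tilt_vertical_down
    (by rw [LinearIsometryEquiv.norm_map, norm_eq_one_of_mem_fccSlots hd₂]) hdown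
  exact twoSlabLedger_twinDown_inPlane_tilt_of_far hs₀ hcert hfar A₁ t₁ A₂ t₂ hμ hA₁ hz hze hd₂ hplane hsteep

end Summit.Ventures.Crystal3D.Theorems

end
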